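import Mathlib

/-!
# Jacobian ideal of a terminal′ series — stub `stub_structure` of line `refutation-cuspidal-edge` (crux stmt-ResolutionOfSingularities-18182, route ShadowGame)

For abstract `κ`-linear operators `D i` on `MvPowerSeries (Fin 3) κ` (`κ` of characteristic
`p`) satisfying the Leibniz rule and killing `p`-th powers, and `f = (∏ w j ^ A j) * v + g ^ p`
with `v` a unit, `p ∤ A k` and invertible constant Jacobian matrix `(constantCoeff (D i (w j)))`,
we show that `(∏ w j ^ (A j - [p ∤ A j])) * ∏_{j ≠ k, p ∤ A j} w j` lies in the ideal
spanned by the `D i f`. Proof: the product and power rules give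
`D i f = M * (w k * Q k * D i v + v * ∑ j, A j * (Q j * D i (w j)))`
(`M` the first factor above, `Q j = ∏_{l ≠ j, p ∤ A l} w l`); contracting with row `k` of the
adjugate of the Jacobian matrix `(D i (w j))` yields `M * Q k * u`, where `u` has the invertible
constant coefficient `A k * v(0) * det (constantCoeff (D i (w j)))`.
-/

noncomputable section

set_option linter.dupNamespace false

namespace Summit.ResolutionOfSingularities.ResolutionOfSingularities.Theorems.ShadowGameWinR.Negative

open MvPowerSeries

/-- An operator satisfying the Leibniz rule kills `1`. [folklore] -/
theorem leibniz_map_one {R : Type} [CommRing R] (D : R → R)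
    (hL : ∀ f g : R, D (f * g) = f * D g + g * D f) : D 1 = 0 := by
  have h := hL 1 1
  rw [one_mul, one_mul] at h
  linear_combination -h

/-- Power rule (exponent `n + 1`) for an operator satisfying the Leibniz rule. [folklore] -/
theorem leibniz_map_pow_succ {R : Type} [CommRing R] (D : R → R)
    (hL : ∀ f g : R, D (f * g) = f * D g + g * D f) (x : R) (n : ℕ) :
    D (x ^ (n + 1)) = (n + 1 : R) * (x ^ n * D x) := by
  induction n with
  | zero => simp
  | succ m ih =>
    rw [pow_succ, hL, ih]
    push_cast
    ring

/-- Power rule for an operator satisfying the Leibniz rule, with the exponent cast into the ring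
(so that it visibly vanishes on multiples of the characteristic). [folklore] -/
theorem leibniz_map_pow {R : Type} [CommRing R] (D : R → R)
    (hL : ∀ f g : R, D (f * g) = f * D g + g * D f) (x : R) (n : ℕ) :
    D (x ^ n) = (n : R) * (x ^ (n - 1) * D x) := by
  cases n with
  | zero => simp [leibniz_map_one D hL]
  | succ m => rw [leibniz_map_pow_succ D hL, Nat.add_sub_cancel, Nat.cast_add_one]

/-- Product rule over a `Finset` for an operator satisfying the Leibniz rule. [folklore] -/
theorem leibniz_map_prod {R : Type} [CommRing R] {ι : Type} [DecidableEq ι] (D : R → R)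
    (hL : ∀ f g : R, D (f * g) = f * D g + g * D f) (u : ι → R) (s : Finset ι) :
    D (∏ j ∈ s, u j) = ∑ j ∈ s, (∏ l ∈ s.erase j, u l) * D (u j) := by
  induction s using Finset.induction_on with
  | empty => simp [leibniz_map_one D hL]
  | insert a s ha ih =>
    rw [Finset.prod_insert ha, hL, ih, Finset.sum_insert ha, Finset.erase_insert ha,
      Finset.mul_sum, add_comm]
    congr 1
    refine Finset.sum_congr rfl fun j hj => ?_
    have hne : a ≠ j := fun h => ha (h ▸ hj)
    rw [Finset.erase_insert_of_ne hne,
      Finset.prod_insert fun h => ha (Finset.mem_of_mem_erase h)]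
    ring

/-- Splitting one copy of each `w l` with `p ∤ A l` off the monomial `∏ w l ^ A l`.
[folklore] -/
theorem monomial_split {R : Type} [CommMonoid R] {ι : Type} (p : ℕ) (w : ι → R)
    (A : ι → ℕ) (s : Finset ι) :
    ∏ l ∈ s, w l ^ A l =
      (∏ l ∈ s, w l ^ (A l - if p ∣ A l then 0 else 1)) *
        ∏ l ∈ s, (if p ∣ A l then 1 else w l) := by
  rw [← Finset.prod_mul_distrib]
  refine Finset.prod_congr rfl fun l _ => ?_
  by_cases h : p ∣ A l
  · simp [h]
  · have h1 : 1 ≤ A l := Nat.pos_of_ne_zero fun h0 => h (h0 ▸ dvd_zero p)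
    rw [if_neg h, if_neg h, ← pow_succ, Nat.sub_add_cancel h1]

/-- Entry `(k, j)` of the identity `adjugate J * J = det J • 1`. [folklore] -/
theorem adjugate_row_mul_col {R : Type} [CommRing R] {ι : Type} [Fintype ι] [DecidableEq ι]
    (J : Matrix ι ι R) (k j : ι) :
    ∑ i, J.adjugate k i * J i j = if k = j then J.det else 0 := by
  have h := congrArg (fun N : Matrix ι ι R => N k j) (Matrix.adjugate_mul J)
  simpa [Matrix.mul_apply, Matrix.one_apply] using h

/-- Algebraic core of the adjugate trick: if
`Df i = M * (wk * Q k * Dv i + v * ∑ j, c j * (Q j * Dw i j))` and the row `a` satisfies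
`∑ i, a i * Dw i j = [k = j] det`, then `∑ i, a i * Df i = M * Q k * u` with
`u = c k * (v * det) + wk * ∑ i, a i * Dv i`. [folklore] -/
theorem adjugate_contraction {R : Type} [CommRing R] {ι : Type} [Fintype ι] [DecidableEq ι]
    (Df Dv a c Q : ι → R) (Dw : ι → ι → R) (M v wk det : R) (k : ι)
    (hDf : ∀ i, Df i = M * (wk * Q k * Dv i + v * ∑ j, c j * (Q j * Dw i j)))
    (hadj : ∀ j, ∑ i, a i * Dw i j = if k = j then det else 0) :
    ∑ i, a i * Df i = M * Q k * (c k * (v * det) + wk * ∑ i, a i * Dv i) := by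
  have h1 : ∀ i, a i * Df i =
      M * (wk * Q k) * (a i * Dv i) + ∑ j, M * v * (c j * Q j) * (a i * Dw i j) := by
    intro i
    rw [hDf]
    simp only [mul_add, Finset.mul_sum]
    congr 1
    · ring
    · exact Finset.sum_congr rfl fun j _ => by ring
  have h2 : ∀ j, ∑ i, M * v * (c j * Q j) * (a i * Dw i j) =
      M * v * (c j * Q j) * (if k = j then det else 0) := by
    intro j
    rw [← hadj j, Finset.mul_sum]
  calc ∑ i, a i * Df i
      = ∑ i, (M * (wk * Q k) * (a i * Dv i) + ∑ j, M * v * (c j * Q j) * (a i * Dw i j)) :=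
        Finset.sum_congr rfl fun i _ => h1 i
    _ = M * (wk * Q k) * ∑ i, a i * Dv i +
          ∑ j, M * v * (c j * Q j) * (if k = j then det else 0) := by
        rw [Finset.sum_add_distrib, Finset.sum_comm, Finset.mul_sum]
        congr 1
        exact Finset.sum_congr rfl fun j _ => h2 j
    _ = M * Q k * (c k * (v * det) + wk * ∑ i, a i * Dv i) := by
        simp only [mul_ite, mul_zero, Finset.sum_ite_eq, Finset.mem_univ, if_true]
        ring

/-- **Stub S4** (structure of the Jacobian ideal of a terminal′ series). For operators `D i` that
are Leibniz and kill `p`-th powers, `f = (∏ w j ^ A j) * v + g ^ p` with `v` a unit, `p ∤ A k`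
and invertible constant Jacobian `(constantCoeff (D i (w j)))`, the monomial
`(∏ w j ^ (A j - [p ∤ A j])) * ∏_{j ≠ k, p ∤ A j} w j` lies in the ideal spanned by the
`D i f`. [folklore] -/
theorem stub_structure (p : ℕ) [Fact p.Prime] (κ : Type) [Field κ] [CharP κ p]
    (D : Fin 3 → (MvPowerSeries (Fin 3) κ →ₗ[κ] MvPowerSeries (Fin 3) κ))
    (hL : ∀ i (f g : MvPowerSeries (Fin 3) κ), D i (f * g) = f * D i g + g * D i f)
    (hP : ∀ i (g : MvPowerSeries (Fin 3) κ), D i (g ^ p) = 0)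
    (w : Fin 3 → MvPowerSeries (Fin 3) κ) (hw0 : ∀ j, constantCoeff (w j) = 0)
    (hdet : IsUnit (Matrix.det (Matrix.of fun i j => constantCoeff (D i (w j)))))
    (A : Fin 3 → ℕ) (k : Fin 3) (hk : ¬ p ∣ A k) (v g f : MvPowerSeries (Fin 3) κ) (hv : IsUnit v)
    (hf : f = (Finset.prod Finset.univ fun j => w j ^ A j) * v + g ^ p) :
    (Finset.prod Finset.univ fun j => w j ^ (A j - if p ∣ A j then 0 else 1)) *
        (Finset.prod ((Finset.univ.erase k).filter fun j => ¬ p ∣ A j) fun j => w j)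
      ∈ Ideal.span (Set.range fun i => D i f) := by
  subst hf
  -- the second factor as `Q k := ∏_{l ≠ k} (if p ∣ A l then 1 else w l)`
  simp only [Finset.prod_filter, ite_not]
  -- casts of multiples of `p` vanish in the power series ring
  have hcast : ∀ j, p ∣ A j → ((A j : ℕ) : MvPowerSeries (Fin 3) κ) = 0 := fun j hj => by
    rw [← map_natCast (algebraMap κ (MvPowerSeries (Fin 3) κ)),
      (CharP.cast_eq_zero_iff κ p _).mpr hj, map_zero]
  -- `P = w k * Q k`
  have hPQ : (∏ l, if p ∣ A l then 1 else w l) =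
      w k * ∏ l ∈ Finset.univ.erase k, if p ∣ A l then 1 else w l := by
    rw [← Finset.mul_prod_erase Finset.univ _ (Finset.mem_univ k), if_neg hk]
  -- the derivatives of `f`
  have hDf : ∀ i, D i ((∏ j, w j ^ A j) * v + g ^ p) =
      (∏ j, w j ^ (A j - if p ∣ A j then 0 else 1)) *
        (w k * (∏ l ∈ Finset.univ.erase k, if p ∣ A l then 1 else w l) * D i v +
          v * ∑ j, (A j : MvPowerSeries (Fin 3) κ) *
            ((∏ l ∈ Finset.univ.erase j, if p ∣ A l then 1 else w l) * D i (w j))) := by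
    intro i
    have hterm : ∀ j, (∏ l ∈ Finset.univ.erase j, w l ^ A l) * D i (w j ^ A j) =
        (∏ j, w j ^ (A j - if p ∣ A j then 0 else 1)) * ((A j : MvPowerSeries (Fin 3) κ) *
          ((∏ l ∈ Finset.univ.erase j, if p ∣ A l then 1 else w l) * D i (w j))) := by
      intro j
      rw [leibniz_map_pow (D i) (hL i)]
      by_cases hj : p ∣ A j
      · simp [hcast j hj]
      · rw [monomial_split p w A (Finset.univ.erase j),
          ← Finset.mul_prod_erase Finset.univ _ (Finset.mem_univ j), if_neg hj]
        ring
    rw [map_add, hP, add_zero, hL, leibniz_map_prod (D i) (hL i),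
      Finset.sum_congr rfl fun j _ => hterm j, ← Finset.mul_sum, monomial_split p w A Finset.univ,
      hPQ]
    ring
  -- row `k` of the adjugate of the Jacobian matrix `(D i (w j))`
  have hadj : ∀ j, ∑ i, (Matrix.of fun i j => D i (w j)).adjugate k i * D i (w j) =
      if k = j then (Matrix.of fun i j => D i (w j)).det else 0 := fun j => by
    simpa only [Matrix.of_apply] using
      adjugate_row_mul_col (Matrix.of fun i j => D i (w j)) k j
  have hsum : ∑ i, (Matrix.of fun i j => D i (w j)).adjugate k i *
        D i ((∏ j, w j ^ A j) * v + g ^ p) =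
      (∏ j, w j ^ (A j - if p ∣ A j then 0 else 1)) *
        (∏ l ∈ Finset.univ.erase k, if p ∣ A l then 1 else w l) *
        ((A k : MvPowerSeries (Fin 3) κ) * (v * (Matrix.of fun i j => D i (w j)).det) +
          w k * ∑ i, (Matrix.of fun i j => D i (w j)).adjugate k i * D i v) :=
    adjugate_contraction (fun i => D i ((∏ j, w j ^ A j) * v + g ^ p)) (fun i => D i v)
      (fun i => (Matrix.of fun i j => D i (w j)).adjugate k i)
      (fun j => (A j : MvPowerSeries (Fin 3) κ))
      (fun j => ∏ l ∈ Finset.univ.erase j, if p ∣ A l then 1 else w l) (fun i j => D i (w j))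
      (∏ j, w j ^ (A j - if p ∣ A j then 0 else 1)) v (w k)
      (Matrix.of fun i j => D i (w j)).det k hDf hadj
  -- the cofactor `u` is a unit of the power series ring
  have hu : IsUnit ((A k : MvPowerSeries (Fin 3) κ) * (v * (Matrix.of fun i j => D i (w j)).det) +
      w k * ∑ i, (Matrix.of fun i j => D i (w j)).adjugate k i * D i v) := by
    rw [MvPowerSeries.isUnit_iff_constantCoeff]
    simp only [map_add, map_mul, map_natCast, hw0, zero_mul, add_zero]
    rw [RingHom.map_det, RingHom.mapMatrix_apply]
    refine isUnit_iff_ne_zero.mpr (mul_ne_zero ?_ (mul_ne_zero ?_ ?_))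
    · exact fun h => hk ((CharP.cast_eq_zero_iff κ p (A k)).mp h)
    · exact (hv.map constantCoeff).ne_zero
    · exact hdet.ne_zero
  have hMQ : (∏ j, w j ^ (A j - if p ∣ A j then 0 else 1)) *
        (∏ l ∈ Finset.univ.erase k, if p ∣ A l then 1 else w l) =
      (∑ i, (Matrix.of fun i j => D i (w j)).adjugate k i *
          D i ((∏ j, w j ^ A j) * v + g ^ p)) * ↑hu.unit⁻¹ := by
    rw [hsum, mul_assoc, IsUnit.mul_val_inv, mul_one]
  rw [hMQ]
  exact Ideal.mul_mem_right _ _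
    (Ideal.sum_mem _ fun i _ => Ideal.mul_mem_left _ _ (Ideal.subset_span ⟨i, rfl⟩))

end Summit.ResolutionOfSingularities.ResolutionOfSingularities.Theorems.ShadowGameWinR.Negative

end
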